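import Summits.Ventures.CertifiedManyBodySolver.Downfold.EmeryOrbitalWeightMonotone
import Summits.Ventures.CertifiedManyBodySolver.Downfold.EmeryOrbitalWeightLever
import HarnessLib

/-!
# THE SHELL THEOREM: every Bloch state of the σ antibonding band in the energy shell between two hole-like Fermi surfaces has Cu-d weight between the NODAL weight of
# the upper surface and the ANTINODAL weight of the lower one — the one-body Cu-d share of EVERY doped carrier, certified

Venture CertifiedManyBodySolver, cell `pub/hubbard-downfold` (stage S1; INFLATION-RULES-3to1-B §B.23 «INFL-3to1 by sign of doping»: in the CORRELATED mVMC solution of the MACE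
three-band Hamiltonians doped holes sit 84–97 % on O-2pσ [lit-1 REFVALS-1 §C17]; §B.72/§B.73: the one-body Fermi-surface weight and its doping levers as theorems), seat
hubbard-downfold-mod-4 (technique B, g29); namespace `Summit.Ventures.CertifiedManyBodySolver.Downfold.Emery`. Joins `EmeryOrbitalWeightMonotone` (`dWeight_mem_Icc_node_face`:
on one contour `w_node(ε) ≤ w_d(k) ≤ w_face(ε)`), `EmeryOrbitalWeightNode` (`dWeightNode_strictAnti`), `EmeryOrbitalWeightFaceLever` (`dWeightFace_strictAnti`, `dcharCubic_face_pos`) and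
`EmeryOrbitalWeightLever`. Everything PROVED (0 sorry). WHAT THIS IS NOT: a statement about any material or about correlated spectral weight; `U = 0` one-body kinematics of the σ
model as printed, rigid band.

* §1 `dcharCubic_diag_eq`: on the zone diagonal `∂_ε charCubic(x, x; ε) = dQuad + (Δ + 4t_pp′x + ε + 4t_pp x)·(nodeGap + ε)` identically, hence **the nodal energy denominator is
  positive** in the regime (`dcharCubic_node_pos`; the `hWn` hypothesis of `dWeight_mem_Icc_node_face` discharged — with `dcharCubic_face_pos` both denominators are now theorems).
* §2 **THE SHELL THEOREM** (`dWeight_shell`): regime `Δ > 0`, `0 ≤ t_pp′ ≤ t_pp`, `t_pp > 0`, `t_pd ≠ 0`; `0 < ε₁ ≤ ε₂`, `t_pp′ε₂ < t_pd²`, lower face-window edge at `ε₁` (`faceG(ε₁) ≥ 0`: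
  the `ε₁`-surface is hole-like) and upper edge at `ε₂` ⇒ for EVERY `ε ∈ [ε₁, ε₂]` and EVERY zone point `(x, y)` of the `ε`-contour:
  **`w_node(ε₂) ≤ w_d(x, y; ε) ≤ w_face(ε₁)`**. Read with `ε₁ = ε_F(x_holes)`, `ε₂ = ε_F(0)`: every one-body state emptied by hole doping is at least as Cu-like as the PARENT's nodal
  quasiparticle and at most as Cu-like as the DOPED surface's antinodal one; with `ε₁ = ε_F(0)`, `ε₂ = ε_F(x_electrons)` the mirror statement for doped electrons.
* §3 BRACKET FORM: `shellCheck Δ a b c e₁ f₂ := faceLeverCheck Δ a b c e₁ f₂ ∧ 0 < b` and `dWeight_shell_of_check` (all `ε ∈ [e₁, f₂]`); `dWeight_shell_of_checks` composes it with two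
  `dwCheck` certificates (`EmeryOrbitalWeightCheck`) at brackets `[e₁, e₂]` and `[f₁, f₂]` into a NUMERIC window `[wnlo(f-bracket), wahi(e-bracket)]` for every state in the shell —
  the census form (`EmeryFermiDWeightShellVKYMR26*`: e.g. every state emptied by 0.16 holes on the La₂CuO₄ (K) row is 66.5–75.1 % Cu-d at one body, against 3–16 % d for the
  doped hole in the correlated solution of §C17 — the located size of what `U` does to the carrier character, now against a theorem-grade baseline).

Sources: three-band model [HybertsenSchluterChristensen1989, Eq. (1)]; [AndersenEtAl1995, §6]; [folklore] algebra.
-/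

noncomputable section

namespace Summit.Ventures.CertifiedManyBodySolver.Downfold.Emery

open Real Set

/-! ## §1 The nodal energy denominator is positive -/

/-- On the zone diagonal `∂_ε charCubic(x, x; ε) = dQuad(x; ε) + (Δ + 4t_pp′x + ε + 4t_pp x)·(nodeGap(x; ε) + ε)` identically (the `ε`-derivative of the factorisation
`charCubic(x, x) = (Δ + 4t_pp′x + ε + 4t_pp x)·dQuad`). [folklore] -/
theorem dcharCubic_diag_eq (Δ tpd tpp c x ε : ℝ) :
    dcharCubic Δ tpd tpp c x x ε = dQuad Δ tpd tpp c x ε + (Δ + 4 * c * x + ε + 4 * tpp * x) * (nodeGap Δ tpp c x ε + ε) := by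
  unfold dcharCubic dcA dfsD dfsN dQuad nodeGap
  ring

/-- **THE NODAL ENERGY DENOMINATOR IS POSITIVE**: `0 < ∂_ε charCubic(xNode, xNode; ε)` for `Δ ≥ 0`, `0 ≤ t_pp′ ≤ t_pp`, `ε > 0`, `t_pd ≠ 0` (at the node `dQuad = 0` and both factors
are positive: `nodeGap_pos`). [folklore] -/
theorem dcharCubic_node_pos {Δ tpd tpp c ε : ℝ} (hΔ : 0 ≤ Δ) (hc : 0 ≤ c) (hct : c ≤ tpp) (hε : 0 < ε) (htpd : tpd ≠ 0) :
    0 < dcharCubic Δ tpd tpp c (xNode Δ tpd tpp c ε) (xNode Δ tpd tpp c ε) ε := by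
  have hN1 := fsN1_pos hct hε.le htpd
  have hx := xNode_pos hΔ hct hε htpd
  have hq := dQuad_xNode (Δ := Δ) hN1.ne'
  have hG := nodeGap_pos hx hε htpd hq
  rw [dcharCubic_diag_eq, hq, zero_add]
  have htpp : 0 ≤ tpp := hc.trans hct
  have h1 : 0 < Δ + 4 * c * xNode Δ tpd tpp c ε + ε + 4 * tpp * xNode Δ tpd tpp c ε := by positivity
  positivity

/-! ## §2 The shell theorem -/

/-- Non-strict nodal lever: `0 < ε₁ ≤ ε₂ ⇒ w_node(ε₂) ≤ w_node(ε₁)`. [folklore] -/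
theorem dWeightNode_antitone {Δ tpd tpp c ε₁ ε₂ : ℝ} (hΔ : 0 < Δ) (hc : 0 ≤ c) (hct : c ≤ tpp) (htpd : tpd ≠ 0) (h1 : 0 < ε₁) (h12 : ε₁ ≤ ε₂) :
    dWeightNode Δ tpd tpp c ε₂ ≤ dWeightNode Δ tpd tpp c ε₁ := by
  rcases eq_or_lt_of_le h12 with h | h
  · rw [h]
  · exact (dWeightNode_strictAnti hΔ hc hct htpd h1 h).le

/-- Non-strict antinodal lever on the window: `0 < ε₁ ≤ ε₂`, `t_pp′ε₂ < t_pd²`, `faceG(ε₁) ≥ 0`, upper edge at `ε₂` ⇒ `w_face(ε₂) ≤ w_face(ε₁)`. [folklore] -/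
theorem dWeightFace_antitone {Δ tpd tpp c ε₁ ε₂ : ℝ} (hΔ : 0 < Δ) (hc : 0 ≤ c) (hct : c ≤ tpp) (htpd : tpd ≠ 0) (h1 : 0 < ε₁) (h12 : ε₁ ≤ ε₂)
    (hm : c * ε₂ < tpd ^ 2) (hlo : 0 ≤ faceG Δ tpd c ε₁) (hhi : cA Δ ε₂ ≤ 8 * fsD Δ tpd c ε₂ + 16 * fsN tpd tpp c ε₂) :
    dWeightFace Δ tpd tpp c ε₂ ≤ dWeightFace Δ tpd tpp c ε₁ := by
  rcases eq_or_lt_of_le h12 with h | h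
  · rw [h]
  · exact (dWeightFace_strictAnti hΔ hc hct htpd h1 h hm hlo hhi).le

/-- **THE SHELL THEOREM**: in the regime (`Δ > 0`, `0 ≤ t_pp′ ≤ t_pp`, `t_pp > 0`, `t_pd ≠ 0`), for `0 < ε₁ ≤ ε₂` with `t_pp′ε₂ < t_pd²`, the `ε₁`-surface hole-like (`faceG(ε₁) ≥ 0`)
and the `ε₂`-surface inside the zone (`cA ≤ 8fsD + 16fsN` at `ε₂`): EVERY zone point `(x, y)` of EVERY contour at `ε ∈ [ε₁, ε₂]` has
**`w_node(ε₂) ≤ w_d(x, y; ε) ≤ w_face(ε₁)`** (and its energy denominator is positive). [folklore] -/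
theorem dWeight_shell {Δ tpd tpp c ε₁ ε₂ ε x y : ℝ} (hΔ : 0 < Δ) (hc : 0 ≤ c) (hct : c ≤ tpp) (htpp : 0 < tpp) (htpd : tpd ≠ 0) (h1 : 0 < ε₁) (h12 : ε₁ ≤ ε₂)
    (hm : c * ε₂ < tpd ^ 2) (hlo : 0 ≤ faceG Δ tpd c ε₁) (hhi : cA Δ ε₂ ≤ 8 * fsD Δ tpd c ε₂ + 16 * fsN tpd tpp c ε₂)
    (hε : ε ∈ Set.Icc ε₁ ε₂) (hx : x ∈ Set.Icc (0 : ℝ) 1) (hy : y ∈ Set.Icc (0 : ℝ) 1) (hP : charCubic Δ tpd tpp c x y ε = 0) :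
    0 < dcharCubic Δ tpd tpp c x y ε ∧ dWeight Δ tpd tpp c x y ε ∈ Set.Icc (dWeightNode Δ tpd tpp c ε₂) (dWeightFace Δ tpd tpp c ε₁) := by
  have hε0 : 0 < ε := lt_of_lt_of_le h1 hε.1
  have hε2 : 0 < ε₂ := lt_of_lt_of_le h1 h12
  have hE : 0 < Δ + ε := by linarith
  have hmε : c * ε < tpd ^ 2 := lt_of_le_of_lt (mul_le_mul_of_nonneg_left hε.2 hc) hm
  have hN : 0 < fsN tpd tpp c ε := fsN_pos htpd hc hct htpp hε0.le
  have hD : 0 < fsD Δ tpd c ε := fsD_pos hE hmε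
  have hN1 : fsN1 tpd tpp c ε ≠ 0 := (fsN1_pos hct hε0.le htpd).ne'
  have hloε : 0 ≤ faceG Δ tpd c ε := hlo.trans (faceG_mono hΔ.le hc h1.le hε.1)
  have hhiε : cA Δ ε ≤ 8 * fsD Δ tpd c ε + 16 * fsN tpd tpp c ε := faceHi_anti hΔ.le hc (by linarith) hε0 hε.2 hhi
  have hWn := dcharCubic_node_pos hΔ.le hc hct hε0 htpd
  have hWa := dcharCubic_face_pos hE hc hct hε0 hmε hloε
  obtain ⟨hW, -⟩ := dWeight_mem_uIcc_of_contour hN hD hε0.le hN1 hWn hWa hx hy hP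
  have hm' := dWeight_mem_Icc_node_face hE hc hct hε0.le hN hD hN1 hWn hWa hx hy hP
  refine ⟨hW, ?_, ?_⟩
  · exact (dWeightNode_antitone hΔ hc hct htpd hε0 hε.2).trans hm'.1
  · exact hm'.2.trans (dWeightFace_antitone hΔ hc hct htpd h1 hε.1 hmε hlo hhiε)

/-! ## §3 Bracket form and the numeric window from two `dwCheck` certificates -/

/-- **`shellCheck`** = `faceLeverCheck` plus `0 < t_pp` (so that `fsN > 0` strictly, as `dWeight_mem_Icc_node_face` wants). [folklore] -/
def shellCheck (Δ a b c e₁ f₂ : ℚ) : Bool := faceLeverCheck Δ a b c e₁ f₂ && decide (0 < b)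

/-- **SOUNDNESS of `shellCheck`**: for every `ε ∈ [e₁, f₂]` and every zone point of the `ε`-contour, `w_node(f₂) ≤ w_d(x, y; ε) ≤ w_face(e₁)` (and the energy denominator is
positive). [folklore] -/
theorem dWeight_shell_of_check {Δ a b c e₁ f₂ : ℚ} (h : shellCheck Δ a b c e₁ f₂ = true) {ε x y : ℝ} (hε : ε ∈ Set.Icc (e₁ : ℝ) f₂)
    (hx : x ∈ Set.Icc (0 : ℝ) 1) (hy : y ∈ Set.Icc (0 : ℝ) 1) (hP : charCubic (Δ : ℝ) a b c x y ε = 0) :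
    0 < dcharCubic (Δ : ℝ) a b c x y ε ∧
      dWeight (Δ : ℝ) a b c x y ε ∈ Set.Icc (dWeightNode (Δ : ℝ) a b c f₂) (dWeightFace (Δ : ℝ) a b c e₁) := by
  simp only [shellCheck, faceLeverCheck, Bool.and_eq_true, decide_eq_true_eq] at h
  obtain ⟨⟨⟨⟨⟨⟨⟨⟨hΔ, hc⟩, hcb⟩, ha⟩, he⟩, hm⟩, hlo⟩, hhi⟩, hb⟩ := h
  refine dWeight_shell (ε₁ := (e₁ : ℝ)) (ε₂ := (f₂ : ℝ)) (by exact_mod_cast hΔ) (by exact_mod_cast hc) (by exact_mod_cast hcb) (by exact_mod_cast hb)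
    (by exact_mod_cast ha) (by exact_mod_cast he) (le_trans hε.1 hε.2) (by exact_mod_cast hm) ?_ ?_ hε hx hy hP
  · unfold faceG; exact_mod_cast hlo
  · unfold cA fsD fsN; exact_mod_cast hhi

/-- **THE NUMERIC SHELL WINDOW**: `shellCheck` at `(e₁, f₂)` plus two `dwCheck` certificates — one on a bracket `[e₁, e₂]` (antinodal window `[walo′, wahi′]`), one on a bracket
`[f₁, f₂]` (nodal window `[wnlo, wnhi]`) — give, for EVERY `ε ∈ [e₁, f₂]` and every zone point of the `ε`-contour, **`wnlo ≤ w_d(x, y; ε) ≤ wahi′`**. [folklore] -/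
theorem dWeight_shell_of_checks {Δ a b c e₁ e₂ f₁ f₂ wnlo wnhi walo wahi wnlo' wnhi' walo' wahi' : ℚ} (h : shellCheck Δ a b c e₁ f₂ = true)
    (hlo : dwCheck Δ a b c e₁ e₂ wnlo' wnhi' walo' wahi' = true) (hhi : dwCheck Δ a b c f₁ f₂ wnlo wnhi walo wahi = true) (he : e₁ ≤ e₂) (hf : f₁ ≤ f₂)
    {ε x y : ℝ} (hε : ε ∈ Set.Icc (e₁ : ℝ) f₂) (hx : x ∈ Set.Icc (0 : ℝ) 1) (hy : y ∈ Set.Icc (0 : ℝ) 1) (hP : charCubic (Δ : ℝ) a b c x y ε = 0) :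
    0 < dcharCubic (Δ : ℝ) a b c x y ε ∧ dWeight (Δ : ℝ) a b c x y ε ∈ Set.Icc (wnlo : ℝ) wahi' := by
  obtain ⟨hW, hwin⟩ := dWeight_shell_of_check h hε hx hy hP
  have h1 : (e₁ : ℝ) ∈ Set.Icc (e₁ : ℝ) e₂ := ⟨le_rfl, by exact_mod_cast he⟩
  have h2 : (f₂ : ℝ) ∈ Set.Icc (f₁ : ℝ) f₂ := ⟨by exact_mod_cast hf, le_rfl⟩
  obtain ⟨-, -, -, -, -, -, -, -, -, hface⟩ := dWeight_nodeFace_of_dwCheck hlo h1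
  obtain ⟨-, -, -, -, -, -, -, -, hnode, -⟩ := dWeight_nodeFace_of_dwCheck hhi h2
  exact ⟨hW, hnode.1.trans hwin.1, hwin.2.trans hface.2⟩

end Summit.Ventures.CertifiedManyBodySolver.Downfold.Emery
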